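import Mathlib
import Summits.ValiantsHypothesis.ValiantsHypothesis.Theorems.GrenetZeonTwoDimCoefficientsDualUnipotentThinNumeratorGauge

/-!
# Crux `GrenetZeon.TwoDimCoefficients` (stmt-ValiantsHypothesis-8062) / rung `DualUnipotentThreeHalves` (stmt-24318):
# the CENTRED NUMERATOR — the pointwise term of the thin-numerator Hessian bound can always be gauged to ZERO

The thin-numerator bound ✓ `rank_hess0_transl_trace_adjugate_mul_le_numerator` (`…ThinNumeratorHessian`, 12th hand) reads,
for affine `A`, `B` with `det A ≡ c ≠ 0` and every point `p`,
`rank Hess_p tr(adj A·B) ≤ 2·m·rank B(p) + 2·rank coeff(B)`, and ✓ `…ThinNumeratorGauge` moves along the gauge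
`B ↦ B + [A, G] + λ·A`.  OBSERVATION of this file: the exact gauge group is larger — for EVERY constant matrix `P`,

  `tr(adj A·(B + A·P)) = tr(adj A·B) + c·tr P`   (`adj A·A = det A·1 = c·1`; `trace_adjugate_mul_add_mul`),

so `B ↦ B + A·P` changes `tr(adj A·B)` by a CONSTANT and leaves every Hessian unchanged (`hess0_transl_add_mul`; the
left-handed `B ↦ B + Q·A` is symmetric).  Since `A(p)` is invertible, the choice `P₀ = −A(p)⁻¹·B(p) = −c⁻¹·adj A(p)·B(p)`
makes the gauged numerator VANISH AT `p` (`map_eval_centred_eq_zero`).  Consequences (all at EVERY point `p`):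

* ★ `rank_hess0_le_of_onesided_gauge` — for every constant `P`: `rank Hess_p ≤ 2·m·rank(B(p) + A(p)·P) + 2·rank coeff(B + A·P)`.
* ★★★ `hess0_transl_eq_centred_cross` — EXACT FORMULA: `Hess_p tr(adj A·B) = −c⁻¹·(Ψ_p + Ψ_pᵀ)` with the CENTRED CROSS FORM
  `Ψ_p(s,t) = tr(J·A_s·J·B°_t)`, `J = adj A(p)`, `B°_t = B_t − A_t·(c⁻¹·J·B(p))` the linear parts of the centred numerator
  `B° = B − A·A(p)⁻¹B(p)` (`A_s`, `B_t` the coefficient matrices of `x_s`, `x_t`).  The "pencil term" `Φ₁` of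
  ✓ `hess0_transl_trace_adjugate_mul_eq` is absorbed: it carried the factor `B(p)`, which the centring kills.
* ★★ `rank_hess0_le_two_rank_centred_cross` / `rank_hess0_le_two_rank_coeff_centred` —
  `rank Hess_p tr(adj A·B) ≤ 2·rank Ψ_p ≤ 2·rank coeff(B°)`: NO factor `m`, NO pointwise term, no Jordan data.
* ★★ `sq_le_two_rank_coeff_centred_of_repr` — per side: `per_n = α·det A + β·tr(adj A·B)` (`n = k + 3`) ⟹ at the
  Mignon–Ressayre point `p₀`: `n² ≤ 2·rank Ψ_{p₀} ≤ 2·rank coeff(B − A·A(p₀)⁻¹B(p₀))`, i.e. the `n²` centred directions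
  `B_t − A_t·A(p₀)⁻¹·B(p₀)` span at least `n²/2` dimensions.

MEANING FOR THE PLAN OF RECORD.  Conjecture (H) HessianRate (`rank Hess_p ≤ C·m²/d`, ✓ `threeHalves_of_hessianRate`) is
therefore EXACTLY a statement about the centred cross form `Ψ_p` on (pencil directions) × (centred numerator directions) — the
thin/fat distinction of the numerator `B(p)` and the Jordan type of `A(p)` (✓ `…JordanGauge*`, this hand, which bounded the
pointwise term by `2·m·#`Jordan blocks) are PRESENTATION ARTEFACTS that the one-sided gauge removes completely.  What is left
is R3′ of the g11 list in its sharpest form: bound `rank Ψ_p` by `C·m²/d` using the trace constraints.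

HONEST FRAMING: helper for an ASIDE crux; closes no stub — `stub_dualUnipotent` (`DualUnipotentBound` ⟺ the crux), the
rung 24318, `stub_longMassSlowLawInv` and `VP ≠ VNP` are untouched.  No definitions, no named facts, no sorry.
-/

noncomputable section

-- single-conjunct layout `Summits/ValiantsHypothesis/ValiantsHypothesis`: the duplicated namespace component is mandated
set_option linter.dupNamespace false

namespace Summit.ValiantsHypothesis.ValiantsHypothesis.Theorems.GrenetZeon.CentredNumerator

open MvPolynomial Matrix
open Literature.Computability.AlgebraicComplexity
open Summit.ValiantsHypothesis.ValiantsHypothesis.Theorems.GrenetZeon.ThinNumerator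

/-! ### §1 The one-sided gauge `B ↦ B + A·P` -/

section Gauge

variable {σ : Type*} {m : ℕ}

/-- The trace of a constant matrix pushed into the polynomial ring. [folklore] -/
theorem trace_map_C (P : Matrix (Fin m) (Fin m) ℂ) :
    (P.map (C : ℂ → MvPolynomial σ ℂ)).trace = C P.trace := by
  simp only [Matrix.trace, Matrix.diag_apply, Matrix.map_apply, map_sum]

/-- **One-sided gauge identity.**  `tr(adj A·(B + A·P)) = tr(adj A·B) + c·tr P` when `det A ≡ c`
(`adj A·A = det A·1`). [folklore] -/
theorem trace_adjugate_mul_add_mul (A B : Matrix (Fin m) (Fin m) (MvPolynomial σ ℂ)) {c : ℂ}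
    (hdet : A.det = C c) (P : Matrix (Fin m) (Fin m) ℂ) :
    (A.adjugate * (B + A * P.map (C : ℂ → MvPolynomial σ ℂ))).trace =
      (A.adjugate * B).trace + C (c * P.trace) := by
  rw [Matrix.mul_add, Matrix.trace_add, ← Matrix.mul_assoc, Matrix.adjugate_mul, hdet, Matrix.smul_mul,
    Matrix.one_mul, Matrix.trace_smul, smul_eq_mul, trace_map_C, ← map_mul]

/-- **Left-handed version.**  `tr(adj A·(B + Q·A)) = tr(adj A·B) + c·tr Q`. [folklore] -/
theorem trace_adjugate_mul_add_mul_left (A B : Matrix (Fin m) (Fin m) (MvPolynomial σ ℂ)) {c : ℂ}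
    (hdet : A.det = C c) (Q : Matrix (Fin m) (Fin m) ℂ) :
    (A.adjugate * (B + Q.map (C : ℂ → MvPolynomial σ ℂ) * A)).trace =
      (A.adjugate * B).trace + C (c * Q.trace) := by
  rw [Matrix.mul_add, Matrix.trace_add, ← Matrix.mul_assoc, Matrix.trace_mul_cycle,
    Matrix.mul_adjugate, hdet, Matrix.smul_mul, Matrix.one_mul, Matrix.trace_smul, smul_eq_mul, trace_map_C,
    ← map_mul]

/-- The one-sided gauge leaves every Hessian unchanged. [folklore] -/
theorem hess0_transl_add_mul (A B : Matrix (Fin m) (Fin m) (MvPolynomial σ ℂ)) {c : ℂ} (hdet : A.det = C c)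
    (P : Matrix (Fin m) (Fin m) ℂ) (p : σ → ℂ) :
    hess0 (transl p (A.adjugate * (B + A * P.map (C : ℂ → MvPolynomial σ ℂ))).trace) =
      hess0 (transl p (A.adjugate * B).trace) := by
  rw [trace_adjugate_mul_add_mul A B hdet P, map_add, transl_C, map_add,
    hess0_eq_zero_of_totalDegree_le_one (f := C (c * P.trace)) (by rw [totalDegree_C]; exact Nat.zero_le _),
    add_zero]

/-- The left-handed gauge leaves every Hessian unchanged. [folklore] -/
theorem hess0_transl_add_mul_left (A B : Matrix (Fin m) (Fin m) (MvPolynomial σ ℂ)) {c : ℂ} (hdet : A.det = C c)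
    (Q : Matrix (Fin m) (Fin m) ℂ) (p : σ → ℂ) :
    hess0 (transl p (A.adjugate * (B + Q.map (C : ℂ → MvPolynomial σ ℂ) * A)).trace) =
      hess0 (transl p (A.adjugate * B).trace) := by
  rw [trace_adjugate_mul_add_mul_left A B hdet Q, map_add, transl_C, map_add,
    hess0_eq_zero_of_totalDegree_le_one (f := C (c * Q.trace)) (by rw [totalDegree_C]; exact Nat.zero_le _),
    add_zero]

/-- The gauged numerator `B + A·P` is affine. [folklore] -/
theorem isAffine_add_mul (A B : Matrix (Fin m) (Fin m) (MvPolynomial σ ℂ))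
    (hA : ∀ i j, (A i j).totalDegree ≤ 1) (hB : ∀ i j, (B i j).totalDegree ≤ 1)
    (P : Matrix (Fin m) (Fin m) ℂ) (i j : Fin m) :
    ((B + A * P.map (C : ℂ → MvPolynomial σ ℂ)) i j).totalDegree ≤ 1 := by
  rw [Matrix.add_apply]
  exact (totalDegree_add _ _).trans (max_le (hB i j) (totalDegree_mul_map_C_le A hA P i j))

/-- Evaluating the gauged numerator: `(B + A·P)(p) = B(p) + A(p)·P`. [folklore] -/
theorem map_eval_add_mul (A B : Matrix (Fin m) (Fin m) (MvPolynomial σ ℂ)) (P : Matrix (Fin m) (Fin m) ℂ)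
    (p : σ → ℂ) :
    (B + A * P.map (C : ℂ → MvPolynomial σ ℂ)).map (eval p) = B.map (eval p) + A.map (eval p) * P := by
  have hP : (P.map (C : ℂ → MvPolynomial σ ℂ)).map (eval p) = P := by
    rw [Matrix.map_map]
    have hc : (⇑(eval p) ∘ (C : ℂ → MvPolynomial σ ℂ)) = id := funext fun x => by simp
    rw [hc, Matrix.map_id]
  have e : ∀ M : Matrix (Fin m) (Fin m) (MvPolynomial σ ℂ), M.map (eval p) = (eval p).mapMatrix M := fun M => rfl
  rw [e, map_add, map_mul, ← e, ← e, ← e, hP]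

/-- Coefficients of the gauged numerator: `coeff_d (B + A·P) = coeff_d B + (coeff_d A)·P` for every exponent `d`
(in particular for the linear parts `d = single t 1`). [folklore] -/
theorem map_coeff_add_mul (A B : Matrix (Fin m) (Fin m) (MvPolynomial σ ℂ)) (P : Matrix (Fin m) (Fin m) ℂ)
    (d : σ →₀ ℕ) :
    (B + A * P.map (C : ℂ → MvPolynomial σ ℂ)).map (coeff d) = B.map (coeff d) + A.map (coeff d) * P := by
  ext i j
  simp only [Matrix.map_apply, Matrix.add_apply, Matrix.mul_apply, coeff_add, coeff_sum]
  refine congrArg _ (Finset.sum_congr rfl fun x _ => ?_)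
  rw [mul_comm, coeff_C_mul, mul_comm]

/-- The determinant of the value `A(p)` is `c`. [folklore] -/
theorem det_map_eval (A : Matrix (Fin m) (Fin m) (MvPolynomial σ ℂ)) {c : ℂ} (hdet : A.det = C c) (p : σ → ℂ) :
    (A.map (eval p)).det = c := by
  have e : A.map (eval p) = (eval p).mapMatrix A := rfl
  rw [e, ← RingHom.map_det, hdet, eval_C]

/-- **Centring.**  With `P₀ = −c⁻¹·adj A(p)·B(p)` (`= −A(p)⁻¹·B(p)`) the gauged numerator vanishes at `p`:
`(B + A·P₀)(p) = 0`. [folklore] -/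
theorem map_eval_centred_eq_zero (A B : Matrix (Fin m) (Fin m) (MvPolynomial σ ℂ)) {c : ℂ} (hc : c ≠ 0)
    (hdet : A.det = C c) (p : σ → ℂ) :
    (B + A * (-(c⁻¹ • ((A.map (eval p)).adjugate * B.map (eval p)))).map (C : ℂ → MvPolynomial σ ℂ)).map (eval p)
      = 0 := by
  rw [map_eval_add_mul, Matrix.mul_neg, Matrix.mul_smul, ← Matrix.mul_assoc, Matrix.mul_adjugate,
    det_map_eval A hdet p, Matrix.smul_mul, Matrix.one_mul, smul_smul, inv_mul_cancel₀ hc, one_smul, add_neg_cancel]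

end Gauge

/-! ### §2 The Hessian bounds after a one-sided gauge; the centred cross form -/

section Bounds

variable {σ : Type*} [Fintype σ] [DecidableEq σ] {m : ℕ}

/-- ★ **One-sided gauged thin-numerator bound.**  For affine `A`, `B` with `det A ≡ c ≠ 0`, every constant `P` and every
point `p`: `rank Hess_p tr(adj A·B) ≤ 2·m·rank(B(p) + A(p)·P) + 2·rank coeff(B + A·P)`. [folklore] -/
theorem rank_hess0_le_of_onesided_gauge (A B : Matrix (Fin m) (Fin m) (MvPolynomial σ ℂ))
    (hA : ∀ i j, (A i j).totalDegree ≤ 1) (hB : ∀ i j, (B i j).totalDegree ≤ 1) {c : ℂ} (hc : c ≠ 0)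
    (hdet : A.det = C c) (P : Matrix (Fin m) (Fin m) ℂ) (p : σ → ℂ) :
    (hess0 (transl p (A.adjugate * B).trace)).rank ≤
      2 * (m * (B.map (eval p) + A.map (eval p) * P).rank) +
        2 * (Matrix.of fun (lk : Fin m × Fin m) (t : σ) =>
          coeff (Finsupp.single t 1) ((B + A * P.map (C : ℂ → MvPolynomial σ ℂ)) lk.1 lk.2)).rank := by
  rw [← hess0_transl_add_mul A B hdet P p, ← map_eval_add_mul A B P p]
  exact rank_hess0_transl_trace_adjugate_mul_le_numerator A _ hA (isAffine_add_mul A B hA hB P) hc hdet p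

/-- ★★★ **The Hessian is the symmetrised CENTRED CROSS FORM.**  For affine `A`, `B` with `det A ≡ c ≠ 0` and every point
`p`: `Hess_p tr(adj A·B) = −c⁻¹·(Ψᵀ + Ψ)`, `Ψ(s,t) = tr(J·A_s·J·B°_t)`, `J = adj A(p)`,
`B°_t = B_t − A_t·(c⁻¹·J·B(p))` (the linear part of the centred numerator `B − A·A(p)⁻¹·B(p)`). [folklore] -/
theorem hess0_transl_eq_centred_cross (A B : Matrix (Fin m) (Fin m) (MvPolynomial σ ℂ))
    (hA : ∀ i j, (A i j).totalDegree ≤ 1) (hB : ∀ i j, (B i j).totalDegree ≤ 1) {c : ℂ} (hc : c ≠ 0)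
    (hdet : A.det = C c) (p : σ → ℂ) :
    hess0 (transl p (A.adjugate * B).trace) =
      (-c⁻¹) • ((Matrix.of fun s t : σ => ((A.map (eval p)).adjugate * A.map (coeff (Finsupp.single s 1)) *
            (A.map (eval p)).adjugate * (B.map (coeff (Finsupp.single t 1)) -
              A.map (coeff (Finsupp.single t 1)) * (c⁻¹ • ((A.map (eval p)).adjugate * B.map (eval p))))).trace)ᵀ +
        (Matrix.of fun s t : σ => ((A.map (eval p)).adjugate * A.map (coeff (Finsupp.single s 1)) *
            (A.map (eval p)).adjugate * (B.map (coeff (Finsupp.single t 1)) -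
              A.map (coeff (Finsupp.single t 1)) * (c⁻¹ • ((A.map (eval p)).adjugate * B.map (eval p))))).trace)) := by
  set P₀ : Matrix (Fin m) (Fin m) ℂ := -(c⁻¹ • ((A.map (eval p)).adjugate * B.map (eval p))) with hP₀
  set B' : Matrix (Fin m) (Fin m) (MvPolynomial σ ℂ) := B + A * P₀.map (C : ℂ → MvPolynomial σ ℂ) with hB'
  have hB'aff : ∀ i j, (B' i j).totalDegree ≤ 1 := isAffine_add_mul A B hA hB P₀
  have key := hess0_transl_trace_adjugate_mul_eq A B' hA hB'aff hc hdet p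
  have h0 : B'.map (eval p) = 0 := by rw [hB', hP₀]; exact map_eval_centred_eq_zero A B hc hdet p
  have hco : ∀ t : σ, B'.map (coeff (Finsupp.single t 1)) =
      B.map (coeff (Finsupp.single t 1)) -
        A.map (coeff (Finsupp.single t 1)) * (c⁻¹ • ((A.map (eval p)).adjugate * B.map (eval p))) := fun t => by
    rw [hB', map_coeff_add_mul, hP₀, Matrix.mul_neg, sub_eq_add_neg]
  rw [hB', hess0_transl_add_mul A B hdet P₀ p, ← hB'] at key
  rw [key, h0]
  refine Matrix.ext fun s t => ?_
  simp only [Matrix.add_apply, Matrix.smul_apply, Matrix.transpose_apply, Matrix.of_apply,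
    Matrix.trace_zero, smul_eq_mul, mul_zero, add_zero, zero_add, hco]

/-- ★★ **Rank form: no pointwise term.**  `rank Hess_p tr(adj A·B) ≤ 2·rank Ψ`, `Ψ` the centred cross form of
`hess0_transl_eq_centred_cross`. [folklore] -/
theorem rank_hess0_le_two_rank_centred_cross (A B : Matrix (Fin m) (Fin m) (MvPolynomial σ ℂ))
    (hA : ∀ i j, (A i j).totalDegree ≤ 1) (hB : ∀ i j, (B i j).totalDegree ≤ 1) {c : ℂ} (hc : c ≠ 0)
    (hdet : A.det = C c) (p : σ → ℂ) :
    (hess0 (transl p (A.adjugate * B).trace)).rank ≤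
      2 * (Matrix.of fun s t : σ => ((A.map (eval p)).adjugate * A.map (coeff (Finsupp.single s 1)) *
            (A.map (eval p)).adjugate * (B.map (coeff (Finsupp.single t 1)) -
              A.map (coeff (Finsupp.single t 1)) * (c⁻¹ • ((A.map (eval p)).adjugate * B.map (eval p))))).trace).rank := by
  rw [hess0_transl_eq_centred_cross A B hA hB hc hdet p]
  refine (rank_smul_le _ _).trans ((rank_add_le' _ _).trans ?_)
  have hT := (Matrix.rank_transpose (Matrix.of fun s t : σ =>
    ((A.map (eval p)).adjugate * A.map (coeff (Finsupp.single s 1)) * (A.map (eval p)).adjugate *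
      (B.map (coeff (Finsupp.single t 1)) -
        A.map (coeff (Finsupp.single t 1)) * (c⁻¹ • ((A.map (eval p)).adjugate * B.map (eval p))))).trace)).le
  omega

/-- ★★ **Rank form in coefficient currency: no pointwise term, no factor `m`.**
`rank Hess_p tr(adj A·B) ≤ 2·rank coeff(B − A·(c⁻¹·adj A(p)·B(p)))`: the Hessian rank at `p` is at most twice the
dimension of the span of the `centred directions` `B_t − A_t·A(p)⁻¹·B(p)`. [folklore] -/
theorem rank_hess0_le_two_rank_coeff_centred (A B : Matrix (Fin m) (Fin m) (MvPolynomial σ ℂ))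
    (hA : ∀ i j, (A i j).totalDegree ≤ 1) (hB : ∀ i j, (B i j).totalDegree ≤ 1) {c : ℂ} (hc : c ≠ 0)
    (hdet : A.det = C c) (p : σ → ℂ) :
    (hess0 (transl p (A.adjugate * B).trace)).rank ≤
      2 * (Matrix.of fun (lk : Fin m × Fin m) (t : σ) =>
        coeff (Finsupp.single t 1)
          ((B + A * (-(c⁻¹ • ((A.map (eval p)).adjugate * B.map (eval p)))).map (C : ℂ → MvPolynomial σ ℂ))
            lk.1 lk.2)).rank := by
  have h := rank_hess0_le_of_onesided_gauge A B hA hB hc hdet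
    (-(c⁻¹ • ((A.map (eval p)).adjugate * B.map (eval p)))) p
  rw [← map_eval_add_mul, map_eval_centred_eq_zero A B hc hdet p, Matrix.rank_zero, mul_zero, mul_zero,
    zero_add] at h
  exact h

end Bounds

/-! ### §3 Per side: the Mignon–Ressayre point -/

section Per

open Summit.ValiantsHypothesis.ValiantsHypothesis.Cruxes.TwoDimCoefficients.DimTwoCases (perPoly_ne_C)

variable {m : ℕ}

/-- The representation survives the one-sided gauge with a shifted `α`:
`per_n = (α − β·tr P)·det A + β·tr(adj A·(B + A·P))`. [folklore] -/
theorem repr_add_mul {n : ℕ} {α β c : ℂ} (A B : Matrix (Fin m) (Fin m) (MvPolynomial (Fin n × Fin n) ℂ))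
    (hdet : A.det = C c)
    (hper : perPoly (Fin n) ℂ = C α * A.det + C β * (A.adjugate * B).trace)
    (P : Matrix (Fin m) (Fin m) ℂ) :
    perPoly (Fin n) ℂ = C (α - β * P.trace) * A.det +
      C β * (A.adjugate * (B + A * P.map (C : ℂ → MvPolynomial (Fin n × Fin n) ℂ))).trace := by
  rw [hper, trace_adjugate_mul_add_mul A B hdet P, hdet, map_sub, map_mul, map_mul]
  ring

/-- ★★ **Per side, centred.**  If `per_n = α·det A + β·tr(adj A·B)` (`n = k + 3`) with `A`, `B` affine `m × m` and
`det A ≡ c ≠ 0`, then at the Mignon–Ressayre point `p₀`: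
`n² ≤ 2·rank coeff(B − A·(c⁻¹·adj A(p₀)·B(p₀)))` — the `n²` centred directions `B_t − A_t·A(p₀)⁻¹·B(p₀)` span at
least `n²/2` dimensions.  (✓ `sq_le_numerator_of_repr` applied to the centred numerator, whose value at `p₀` is `0`.)
[folklore] -/
theorem sq_le_two_rank_coeff_centred_of_repr (k : ℕ) {α β c : ℂ}
    (A B : Matrix (Fin m) (Fin m) (MvPolynomial (Fin (k + 3) × Fin (k + 3)) ℂ))
    (hA : ∀ i j, (A i j).totalDegree ≤ 1) (hB : ∀ i j, (B i j).totalDegree ≤ 1) (hc : c ≠ 0)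
    (hdet : A.det = C c)
    (hper : perPoly (Fin (k + 3)) ℂ = C α * A.det + C β * (A.adjugate * B).trace) :
    (k + 3) ^ 2 ≤
      2 * (Matrix.of fun (lk : Fin m × Fin m) (t : Fin (k + 3) × Fin (k + 3)) =>
        coeff (Finsupp.single t 1)
          ((B + A * (-(c⁻¹ • ((A.map (eval (mrPoint ℂ k))).adjugate * B.map (eval (mrPoint ℂ k))))).map
            (C : ℂ → MvPolynomial (Fin (k + 3) × Fin (k + 3)) ℂ)) lk.1 lk.2)).rank := by
  set P₀ : Matrix (Fin m) (Fin m) ℂ :=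
    -(c⁻¹ • ((A.map (eval (mrPoint ℂ k))).adjugate * B.map (eval (mrPoint ℂ k)))) with hP₀
  have h := sq_le_numerator_of_repr k A (B + A * P₀.map C) hA (isAffine_add_mul A B hA hB P₀) hc hdet
    (repr_add_mul A B hdet hper P₀)
  rw [hP₀, map_eval_centred_eq_zero A B hc hdet (mrPoint ℂ k), Matrix.rank_zero, mul_zero, mul_zero,
    zero_add] at h
  exact h

/-- ★★ **Per side, centred cross form.**  Same hypotheses: `n² ≤ 2·rank Ψ_{p₀}`, `Ψ_{p₀}(s,t) = tr(J·A_s·J·B°_t)` the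
centred cross form at the Mignon–Ressayre point (`J = adj A(p₀)`, `B°_t = B_t − A_t·(c⁻¹·J·B(p₀))`). [folklore] -/
theorem sq_le_two_rank_centred_cross_of_repr (k : ℕ) {α β c : ℂ}
    (A B : Matrix (Fin m) (Fin m) (MvPolynomial (Fin (k + 3) × Fin (k + 3)) ℂ))
    (hA : ∀ i j, (A i j).totalDegree ≤ 1) (hB : ∀ i j, (B i j).totalDegree ≤ 1) (hc : c ≠ 0)
    (hdet : A.det = C c)
    (hper : perPoly (Fin (k + 3)) ℂ = C α * A.det + C β * (A.adjugate * B).trace) :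
    (k + 3) ^ 2 ≤
      2 * (Matrix.of fun s t : Fin (k + 3) × Fin (k + 3) =>
        ((A.map (eval (mrPoint ℂ k))).adjugate * A.map (coeff (Finsupp.single s 1)) *
          (A.map (eval (mrPoint ℂ k))).adjugate * (B.map (coeff (Finsupp.single t 1)) -
            A.map (coeff (Finsupp.single t 1)) *
              (c⁻¹ • ((A.map (eval (mrPoint ℂ k))).adjugate * B.map (eval (mrPoint ℂ k)))))).trace).rank := by
  set T : MvPolynomial (Fin (k + 3) × Fin (k + 3)) ℂ := (A.adjugate * B).trace with hT
  have hβ : β ≠ 0 := by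
    intro hβ0
    apply perPoly_ne_C (n := k + 3) (by omega) (α * c)
    rw [hper, hdet, hβ0, map_zero, zero_mul, add_zero, ← C_mul]
  have e1 : transl (mrPoint ℂ k) (perPoly (Fin (k + 3)) ℂ) =
      MvPolynomial.C (α * c) + MvPolynomial.C β * transl (mrPoint ℂ k) T := by
    rw [hper, hdet, map_add, map_mul, map_mul, transl_C, transl_C, transl_C, ← C_mul]
  have hHess : hess0 (transl (mrPoint ℂ k) (perPoly (Fin (k + 3)) ℂ)) =
      β • hess0 (transl (mrPoint ℂ k) T) := by
    rw [e1, map_add, hess0_C_mul,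
      hess0_eq_zero_of_totalDegree_le_one (by rw [totalDegree_C]; exact Nat.zero_le _), zero_add]
  have hrank : (hess0 (transl (mrPoint ℂ k) T)).rank = (k + 3) ^ 2 := by
    rw [← rank_smul_eq hβ, ← hHess, hess0_transl_mrPoint_perPoly,
      rank_smul_eq (by exact_mod_cast Nat.factorial_ne_zero k), rank_mrHess]
  rw [← hrank, hT]
  exact rank_hess0_le_two_rank_centred_cross A B hA hB hc hdet (mrPoint ℂ k)

end Per

end Summit.ValiantsHypothesis.ValiantsHypothesis.Theorems.GrenetZeon.CentredNumerator

end
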